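import Literature.Probability.Percolation.SlabRSWSnapSurgery
import Literature.Probability.Percolation.SlabRSWSnapLayout
import Literature.Probability.Percolation.SlabRSWGluingBound
import HarnessLib

/-!
# Newman–Tassion–Wu 2017, Lemma 3.16 — the local modification of the coarse-grained datum from a
# free routing region: plain surgery or surgery ending in `B̄`

Topic: `Literature/Probability/Percolation`. The decision between the two surgeries of
`SlabRSWSnapSurgery.lean` and the bookkeeping around the anchor. Data (`gadget_of_local`): a lattice
configuration of `𝒳` for `Q₂ = snapGlue n hn Γ`; a frame of a point `p` with `p ∉ M = N ∪ τN`, its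
box `B₀` free of `A`- and `C`-cells; a free routing region `K ∋ p` inside the box with a router; an
ANCHOR `g⋆ ∈ Γ₁` over `p` that is not the last vertex of `Γ₁`, a second vertex of `Γ₁` adjacent to it,
and the normalised contact, whose end is within `1` of a vertex `g₀` of `Γ₁` equal to `g⋆` or to the
last vertex of `Γ₁` if that one is adjacent to `g⋆`; the two "closeness" facts of the layout (cells of
the box within `1` of `p`, or within `1` of a tile cell adjacent to `p`, are in `K` or in a tile); the
port chains through `M` and — when no cell of `τN ∖ N` of the box is adjacent to `K` — through `N`;
and two target pairs when some cell of `τN ∖ N` of the box IS adjacent to `K`. Conclusion: a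
`GadgetSpec Q₂ k 14`.

The one geometric lemma proved here (`hub_mem_of_diag`): if the two axis-neighbours of `p` towards a
diagonal neighbour `z` are tile cells of `N`, then so is `z` (it is the hub).

## Sources

* C. M. Newman, V. Tassion, W. Wu, *Critical percolation and the minimal spanning tree in slabs*,
  Comm. Pure Appl. Math. 70 (2017), arXiv:1512.09107: §3.2, proof of Theorem 3.7 (the map
  `Φ : 𝒳 → 𝔓(𝒳′)`); §3.5, proof of Lemma 3.16 [NewmanTassionWu2017].
-/

noncomputable section

namespace Literature.Probability.Percolation

open MeasureTheory LatticeModels SimpleGraph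

namespace NTW17

variable {k : ℕ}

section Diag

variable {n : ℕ} {p : ℤ × ℤ} {x₁ x₂ y₁ y₂ X Y : ℤ} {C : Set (ℤ × ℤ)}

/-- **A diagonal neighbour of `p` flanked by two tile cells is a tile cell** (it is the hub): for a
frame of `p ∉ U`, if `(p.1 + δ₁, p.2)` and `(p.1, p.2 + δ₂)` (`δᵢ = ±1`) are in `U`, so is
`(p.1 + δ₁, p.2 + δ₂)` when it lies in the box (`δ₂ = ±1`; `δ₁` is then forced by the tiles).
[cite: NewmanTassionWu2017, §3.5 (proof of Lemma 3.16, "K_□ … regular enough")] -/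
theorem hub_mem_of_diag (hF : IsFrame n p x₁ x₂ y₁ y₂ X Y) (hW : IsFrameND n x₁ x₂ y₁ X Y)
    (hC : ∀ c ∈ C, LatCentre n c) (hpU : p ∉ tileUnion C) {δ₁ δ₂ : ℤ} (hδ₂ : δ₂ = 1 ∨ δ₂ = -1)
    (ha : (p.1 + δ₁, p.2) ∈ tileUnion C) (haB : (p.1 + δ₁, p.2) ∈ boxR x₁ x₂ y₁ y₂)
    (hb : (p.1, p.2 + δ₂) ∈ tileUnion C) (hbB : (p.1, p.2 + δ₂) ∈ boxR x₁ x₂ y₁ y₂)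
    (hzB : (p.1 + δ₁, p.2 + δ₂) ∈ boxR x₁ x₂ y₁ y₂) : (p.1 + δ₁, p.2 + δ₂) ∈ tileUnion C := by
  have key := layout_key hF hW hC hpU
  obtain ⟨lo, hi, lo', hi', hxT, hyT, hcov, hain, hnp⟩ := key _ ha haB
  obtain ⟨lo₂, hi₂, lo₂', hi₂', hxT₂, hyT₂, hcov₂, hbin, hnp₂⟩ := key _ hb hbB
  rw [mem_boxR_iff] at haB hbB hzB
  simp only at hain hbin haB hbB hzB
  have hpx₁ := hF.hpx₁; have hpx₂ := hF.hpx₂; have hpy₁ := hF.hpy₁; have hpy₂ := hF.hpy₂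
  -- `a`'s tile excludes `p` horizontally: the line `X` is `p.1 + δ₁`-sided …; likewise `Y`;
  -- then the hub `(X, Y) = (p.1 + δ₁, p.2 + δ₂)` lies in `a`'s tile
  exact hcov _ (by simp only; omega) (by simp only; omega) (by simp only; omega) (by simp only; omega)
    hzB.1 hzB.2.1 hzB.2.2.1 hzB.2.2.2

end Diag

section Local

variable {n : ℕ} (hn : 1 ≤ n) {Γ : List (slab 3 k)} {ω : BondConfig (slab 3 k)}
variable {p : ℤ × ℤ} {x₁ x₂ y₁ y₂ X Y : ℤ} {K : Set (ℤ × ℤ)}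

/-- **The local modification from a free routing region.** See the module docstring.
[cite: NewmanTassionWu2017, §3.2 (proof of Theorem 3.7, the map Φ); §3.5 (proof of Lemma 3.16)] -/
theorem gadget_of_local (hk : 1 ≤ k)
    (hΓ : ∀ g ∈ Γ, 0 ≤ (planar k g).1 ∧ (planar k g).1 ≤ 7 * n ∧ 0 ≤ (planar k g).2)
    (hω : ω ⊆ (slabGraph 3 k).edgeSet) (hX : ω ∈ (snapGlue k n hn Γ).evX k)
    (hF : IsFrame n p x₁ x₂ y₁ y₂ X Y) (hW : IsFrameND n x₁ x₂ y₁ X Y)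
    (hpM : p ∉ snapNbhd k n Γ ∪ snapNbhdR k n Γ)
    (hBA : ∀ z ∈ boxR x₁ x₂ y₁ y₂, z ∉ (snapGlue k n hn Γ).A)
    (hBC : ∀ z ∈ boxR x₁ x₂ y₁ y₂, z ∉ (snapGlue k n hn Γ).C)
    (hKB : K ⊆ boxR x₁ x₂ y₁ y₂) (hKM : ∀ z ∈ K, z ∉ snapNbhd k n Γ ∧ z ∉ snapNbhdR k n Γ)
    (hpK : p ∈ K)
    (hroute : ∀ (E₁ E₂ w : slab 3 k), planar k E₁ ∈ K → planar k E₂ ∈ K → planar k w ∈ K → E₁ ≠ E₂ →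
      planar k E₁ ≠ planar k w → planar k E₂ ≠ planar k w → ∃ L Br c, RouteSpec k K K E₁ E₂ w L Br c)
    -- closeness: cells of the box within `1` of `p`, or of a tile cell adjacent to `p`, are in `K ∪ M`
    (hZ : ∀ g : ℤ × ℤ, (g = p ∨ (g ∈ snapNbhd k n Γ ∪ snapNbhdR k n Γ ∧ planarAdj p g)) →
      ∀ z ∈ boxR x₁ x₂ y₁ y₂, z ∈ sqBox g 1 → z ∈ K ∨ z ∈ snapNbhd k n Γ ∪ snapNbhdR k n Γ)
    -- port chains through `M`
    (hchainM : ∀ t : ℤ × ℤ, t ∈ snapNbhd k n Γ ∪ snapNbhdR k n Γ → t ∈ boxR x₁ x₂ y₁ y₂ → t ∉ K →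
      ∀ f₁ f₂ : ℤ × ℤ, ∃ e m : ℤ × ℤ, e ∈ K ∧ e ≠ f₁ ∧ e ≠ f₂ ∧ planarAdj e m ∧
        ∃ l' : List (ℤ × ℤ), PPath l' m t ∧
          ∀ z ∈ l', (z ∈ snapNbhd k n Γ ∪ snapNbhdR k n Γ ∧ z ∈ boxR x₁ x₂ y₁ y₂) ∧ z ∉ K)
    -- port chains through `N`, when no cell of `τN ∖ N` in the box is adjacent to `K`
    (hchainN : (∀ t ∈ boxR x₁ x₂ y₁ y₂, t ∈ snapNbhdR k n Γ → t ∉ snapNbhd k n Γ → ∀ b ∈ K, ¬planarAdj b t) →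
      ∀ t : ℤ × ℤ, t ∈ snapNbhd k n Γ → t ∈ boxR x₁ x₂ y₁ y₂ → t ∉ K →
      ∀ f₁ f₂ : ℤ × ℤ, ∃ e m : ℤ × ℤ, e ∈ K ∧ e ≠ f₁ ∧ e ≠ f₂ ∧ planarAdj e m ∧
        ∃ l' : List (ℤ × ℤ), PPath l' m t ∧ ∀ z ∈ l', (z ∈ snapNbhd k n Γ ∧ z ∈ boxR x₁ x₂ y₁ y₂) ∧ z ∉ K)
    -- two target pairs, when some cell of `τN ∖ N` in the box is adjacent to `K`
    (hpairs : (∃ t ∈ boxR x₁ x₂ y₁ y₂, t ∈ snapNbhdR k n Γ ∧ t ∉ snapNbhd k n Γ ∧ ∃ b ∈ K, planarAdj b t) →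
      ∃ b₁ t₁ b₂ t₂ : ℤ × ℤ, b₁ ∈ K ∧ b₂ ∈ K ∧ b₁ ≠ b₂ ∧
        (t₁ ∈ snapNbhdR k n Γ ∧ t₁ ∉ snapNbhd k n Γ ∧ t₁ ∈ boxR x₁ x₂ y₁ y₂) ∧
        (t₂ ∈ snapNbhdR k n Γ ∧ t₂ ∉ snapNbhd k n Γ ∧ t₂ ∈ boxR x₁ x₂ y₁ y₂) ∧
        planarAdj b₁ t₁ ∧ planarAdj b₂ t₂)
    -- the anchor `g⋆` (over `p`, not last), a neighbour `u` of it on `Γ₁`, and the vertex `g₀` near the contact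
    {gs u g₀ : slab 3 k} (hgs : gs ∈ (snapGlue k n hn Γ).γ k ω) (hgsp : planar k gs = p)
    (hgsl : ∀ hne : (snapGlue k n hn Γ).γ k ω ≠ [], gs ≠ ((snapGlue k n hn Γ).γ k ω).getLast hne)
    (hu : u ∈ (snapGlue k n hn Γ).γ k ω) (hugs : u ≠ gs) (huadj : (slabGraph 3 k).Adj u gs)
    (hg₀ : g₀ ∈ (snapGlue k n hn Γ).γ k ω)
    (hg₀gs : g₀ = gs ∨ ((slabGraph 3 k).Adj g₀ gs ∧
      ∀ hne : (snapGlue k n hn Γ).γ k ω ≠ [], g₀ = ((snapGlue k n hn Γ).γ k ω).getLast hne))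
    -- the contact
    {c₀ q : slab 3 k} {l : List (slab 3 k)} (hc₀ : c₀ ∈ slabLift k (snapGlue k n hn Γ).C)
    (hch : (l ++ [q]).IsChain (fun a b => s(a, b) ∈ ω ∧ a ≠ b)) (hnd : (l ++ [q]).Nodup)
    (hsub : ∀ x ∈ l ++ [q], x ∈ slabLift k (snapGlue k n hn Γ).R) (hhead : (l ++ [q]).head (by simp) = c₀)
    (hfar : ∀ x ∈ l, ¬Near k ((snapGlue k n hn Γ).γ k ω) 1 (planar k x)) (hl : l ≠ [])
    (hqg₀ : planar k q ∈ sqBox (planar k g₀) 1) :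
    ∃ ω', GadgetSpec (snapGlue k n hn Γ) k 14 ω ω' := by
  set Q := snapGlue k n hn Γ with hQ
  set B := boxR x₁ x₂ y₁ y₂ with hBdef
  set M := snapNbhd k n Γ ∪ snapNbhdR k n Γ with hM
  have hA : ω ∈ Q.evAB k := hX.1
  obtain ⟨hγO, -⟩ := Q.γ_spec hA
  have hne : Q.γ k ω ≠ [] := hγO.ne_nil
  have hpx₁ := hF.hpx₁; have hpx₂ := hF.hpx₂; have hpy₁ := hF.hpy₁; have hpy₂ := hF.hpy₂
  have hdx₁ := hF.hdx₁; have hdx₂ := hF.hdx₂; have hdy₁ := hF.hdy₁; have hdy₂ := hF.hdy₂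
  have hx₁ := hF.hx₁; have hx₂ := hF.hx₂; have hy₁ := hF.hy₁; have hy₂ := hF.hy₂
  have hbx₁ := hF.hbx₁; have hbx₂ := hF.hbx₂; have hby₁ := hF.hby₁; have hby₂ := hF.hby₂
  have memB : ∀ z : ℤ × ℤ, z ∈ B ↔ x₁ ≤ z.1 ∧ z.1 ≤ x₂ ∧ y₁ ≤ z.2 ∧ z.2 ≤ y₂ := fun z => by
    rw [hBdef, mem_boxR_iff]
  have hBR : B ⊆ boxR 0 (14 * n) 0 (13 * n - 1) := fun z hz => by
    rw [mem_boxR_iff]; rw [memB] at hz; omega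
  -- facts about the vertices of `Γ₁`
  have hγR : ∀ v ∈ Q.γ k ω, 0 ≤ (planar k v).1 ∧ (planar k v).1 ≤ 14 * n ∧ 0 ≤ (planar k v).2 ∧
      (planar k v).2 ≤ 13 * n - 1 := by
    intro v hv
    have := Q.γ_subset_R hA hv
    rw [mem_slabLift_iff, hQ, snapGlue_mem_R_iff] at this
    exact this
  have hγN : ∀ v ∈ Q.γ k ω, planar k v ∉ snapNbhd k n Γ := by
    intro v hv
    have := hγO.subset v hv
    rw [mem_slabLift_iff, hQ, snapGlue_S] at this
    exact this.2
  have hγM : ∀ v ∈ Q.γ k ω, v ≠ (Q.γ k ω).getLast hne → planar k v ∉ M := by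
    intro v hv hvl hvM
    rcases hvM with h | h
    · exact hγN v hv h
    · exact hvl (eq_getLast_of_mem_B hA hv (by rw [mem_slabLift_iff, hQ, snapGlue_B]; exact ⟨h, hγN v hv⟩))
  have hlastB : planar k ((Q.γ k ω).getLast hne) ∈ Q.B := by
    have := hγO.last_mem hne; rwa [mem_slabLift_iff] at this
  -- near cells are in the box
  have hnearB : ∀ z : ℤ × ℤ, 0 ≤ z.1 → z.1 ≤ 14 * n → 0 ≤ z.2 → z.2 ≤ 13 * n - 1 → z ∈ sqBox p 2 → z ∈ B := by
    intro z h1 h2 h3 h4 hz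
    rw [mem_sqBox_iff'] at hz; rw [memB]; push_cast at hz; omega
  -- the box is within `14` of `p`
  have hB14 : B ⊆ sqBox p 14 := fun z hz => by rw [memB] at hz; rw [mem_sqBox_iff']; push_cast; omega
  -- `u` is a cell off `p`, within `1`
  have hup : planar k u ∈ sqBox p 1 := by rw [← hgsp]; exact planar_mem_sqBox_one_of_adj huadj.symm
  have huR := hγR u hu
  have huB : planar k u ∈ B := hnearB _ huR.1 huR.2.1 huR.2.2.1 huR.2.2.2 (sqBox_mono _ (by norm_num) hup)
  -- the contact cell
  have hqR : 0 ≤ (planar k q).1 ∧ (planar k q).1 ≤ 14 * n ∧ 0 ≤ (planar k q).2 ∧ (planar k q).2 ≤ 13 * n - 1 := by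
    have := hsub q (by simp)
    rw [mem_slabLift_iff, hQ, snapGlue_mem_R_iff] at this
    exact this
  have hg₀p : planar k g₀ ∈ sqBox p 1 := by
    rcases hg₀gs with rfl | ⟨hadj, -⟩
    · rw [hgsp]; exact mem_sqBox_self _ _
    · rw [← hgsp]; exact planar_mem_sqBox_one_of_adj hadj.symm
  have hqp : planar k q ∈ sqBox p 2 := mem_sqBox_add hg₀p hqg₀
  have hqB : planar k q ∈ B := hnearB _ hqR.1 hqR.2.1 hqR.2.2.1 hqR.2.2.2 hqp
  -- the dichotomy
  by_cases hT : ∃ t ∈ B, t ∈ snapNbhdR k n Γ ∧ t ∉ snapNbhd k n Γ ∧ ∃ b ∈ K, planarAdj b t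
  · -- surgery ending in `B̄`
    obtain ⟨b₁, t₁, b₂, t₂, hb₁, hb₂, hb, ht₁, ht₂, hadj₁, hadj₂⟩ := hpairs hT
    have hqD : planar k q ∈ K ∪ (M ∩ B) := by
      have hg₀' : planar k g₀ = p ∨ (planar k g₀ ∈ M ∧ planarAdj p (planar k g₀)) := by
        rcases hg₀gs with rfl | ⟨hadj, hlast⟩
        · exact Or.inl hgsp
        · right
          have hg₀B : planar k g₀ ∈ Q.B := by rw [hlast hne]; exact hlastB
          rw [hQ, snapGlue_B] at hg₀B
          refine ⟨Or.inr hg₀B.1, ?_⟩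
          rcases (slab_adj_iff g₀ gs).1 hadj with ⟨-, hpl⟩ | ⟨hpl, -⟩
          · rw [hgsp] at hpl; exact planarAdj_symm hpl
          · exfalso; apply hpM; rw [← hgsp, ← hpl]; exact Or.inr hg₀B.1
      rcases hZ (planar k g₀) hg₀' (planar k q) hqB hqg₀ with h | h
      · exact Or.inl h
      · exact Or.inr ⟨h, hqB⟩
    obtain ⟨sb, hsb⟩ := exists_surgeryB_snap hn hk hω hX hBR hBA hBC hKB hKM hroute
      ⟨gs, hgs, hgsp ▸ hpK, hgsl⟩ hb₁ hb₂ hb ht₁ ht₂ hadj₁ hadj₂ hc₀ hch hnd hsub hhead hfar hl hqD hchainM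
    refine ⟨_, GadgetSpec.of_surgeryB hX sb ⟨p, ?_⟩⟩
    rw [hsb]
    rintro z (hz | ⟨-, hz⟩)
    · exact hB14 (hKB hz)
    · exact hB14 hz
  · -- plain surgery
    have hT' : ∀ t ∈ B, t ∈ snapNbhdR k n Γ → t ∉ snapNbhd k n Γ → ∀ b ∈ K, ¬planarAdj b t := by
      intro t htB htR htN b hb hadj
      exact hT ⟨t, htB, htR, htN, b, hb, hadj⟩
    -- a tile cell adjacent to a cell of `K` is in `N`
    have hadjN : ∀ t ∈ B, t ∈ M → ∀ b ∈ K, planarAdj b t → t ∈ snapNbhd k n Γ := by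
      intro t htB htM b hb hadj
      by_contra htN
      rcases htM with h | h
      · exact htN h
      · exact hT' t htB h htN b hb hadj
    -- `g₀ = g⋆`: otherwise the last vertex, a cell of `τN ∖ N` adjacent to `p ∈ K`
    have hg₀eq : g₀ = gs := by
      rcases hg₀gs with h | ⟨hadj, hlast⟩
      · exact h
      · exfalso
        have hg₀B : planar k g₀ ∈ Q.B := by rw [hlast hne]; exact hlastB
        rw [hQ, snapGlue_B] at hg₀B
        rcases (slab_adj_iff g₀ gs).1 hadj with ⟨-, hpl⟩ | ⟨hpl, -⟩
        · rw [hgsp] at hpl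
          have hg₀Bx : planar k g₀ ∈ B :=
            hnearB _ (hγR g₀ hg₀).1 (hγR g₀ hg₀).2.1 (hγR g₀ hg₀).2.2.1 (hγR g₀ hg₀).2.2.2
              (sqBox_mono _ (by norm_num) hg₀p)
          exact hT' _ hg₀Bx hg₀B.1 hg₀B.2 p hpK (planarAdj_symm hpl)
        · apply hpM; rw [← hgsp, ← hpl]; exact Or.inr hg₀B.1
    subst hg₀eq
    rw [hgsp] at hqg₀
    -- `u` is over `K`
    have hul : u ≠ (Q.γ k ω).getLast hne := by
      intro hul
      have huBQ : planar k u ∈ Q.B := by rw [hul]; exact hlastB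
      rw [hQ, snapGlue_B] at huBQ
      rcases (slab_adj_iff u g₀).1 huadj with ⟨-, hpl⟩ | ⟨hpl, -⟩
      · rw [hgsp] at hpl
        exact hT' _ huB huBQ.1 huBQ.2 p hpK (planarAdj_symm hpl)
      · apply hpM; rw [← hgsp, ← hpl]; exact Or.inr huBQ.1
    have huM : planar k u ∉ M := hγM u hu hul
    have huK : planar k u ∈ K := by
      rcases hZ p (Or.inl rfl) (planar k u) huB hup with h | h
      · exact h
      · exact absurd h huM
    -- the contact cell is over `K ∪ (N ∩ B)`
    have hC_N : ∀ c ∈ snapCentres k n Γ, LatCentre n c := fun c hc => latCentre_snapCentres hΓ hc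
    have hqD : planar k q ∈ K ∪ (snapNbhd k n Γ ∩ B) := by
      rcases hZ p (Or.inl rfl) (planar k q) hqB hqg₀ with h | hqM
      · exact Or.inl h
      right
      refine ⟨?_, hqB⟩
      -- `planar q` is a tile cell within `1` of `p`: adjacent (then in `N`) or diagonal
      set z := planar k q with hz
      rw [mem_sqBox_iff'] at hqg₀
      push_cast at hqg₀
      by_cases hadj : planarAdj p z
      · exact hadjN z hqB hqM p hpK hadj
      · -- diagonal: `z = (p.1 + δ₁, p.2 + δ₂)`
        have hzne : z ≠ p := fun h => hpM (h ▸ hqM)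
        obtain ⟨δ₁, δ₂, hδ₁, hδ₂, hzeq⟩ : ∃ δ₁ δ₂ : ℤ, (δ₁ = 1 ∨ δ₁ = -1) ∧ (δ₂ = 1 ∨ δ₂ = -1) ∧
            z = (p.1 + δ₁, p.2 + δ₂) := by
          have h1 : z.1 ≠ p.1 ∨ z.2 ≠ p.2 := by
            by_contra h; push Not at h; exact hzne (Prod.ext h.1 h.2)
          have hna : ¬((z.1 = p.1 ∧ (z.2 = p.2 + 1 ∨ z.2 = p.2 - 1)) ∨
              (z.2 = p.2 ∧ (z.1 = p.1 + 1 ∨ z.1 = p.1 - 1))) := by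
            intro h; apply hadj
            simp only [planarAdj, Prod.ext_iff, Prod.fst_add, Prod.snd_add]
            omega
          refine ⟨z.1 - p.1, z.2 - p.2, by omega, by omega, Prod.ext (by simp) (by simp)⟩
        -- the two axis neighbours
        have haR : (p.1 + δ₁, p.2) ∈ B := by rw [memB]; rw [memB] at hqB; rw [hzeq] at hqB; simp only at hqB ⊢; omega
        have hbR : (p.1, p.2 + δ₂) ∈ B := by rw [memB]; rw [memB] at hqB; rw [hzeq] at hqB; simp only at hqB ⊢; omega
        have haz : (p.1 + δ₁, p.2) ∈ sqBox p 1 := by rw [mem_sqBox_iff']; simp only; push_cast; omega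
        have hbz : (p.1, p.2 + δ₂) ∈ sqBox p 1 := by rw [mem_sqBox_iff']; simp only; push_cast; omega
        have hadja : planarAdj (p.1 + δ₁, p.2) z := by
          rw [hzeq]; simp only [planarAdj, Prod.ext_iff, Prod.fst_add, Prod.snd_add]; omega
        have hadjb : planarAdj (p.1, p.2 + δ₂) z := by
          rw [hzeq]; simp only [planarAdj, Prod.ext_iff, Prod.fst_add, Prod.snd_add]; omega
        rcases hZ p (Or.inl rfl) _ haR haz with haK | haM
        · exact hadjN z hqB hqM _ haK hadja
        rcases hZ p (Or.inl rfl) _ hbR hbz with hbK | hbM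
        · exact hadjN z hqB hqM _ hbK hadjb
        have hpa : planarAdj p (p.1 + δ₁, p.2) := by
          simp only [planarAdj, Prod.ext_iff, Prod.fst_add, Prod.snd_add]; omega
        have hpb : planarAdj p (p.1, p.2 + δ₂) := by
          simp only [planarAdj, Prod.ext_iff, Prod.fst_add, Prod.snd_add]; omega
        have haN := hadjN _ haR haM p hpK hpa
        have hbN := hadjN _ hbR hbM p hpK hpb
        have hpN : p ∉ snapNbhd k n Γ := fun h => hpM (Or.inl h)
        rw [snapNbhd_eq_tileUnion] at haN hbN hpN ⊢
        rw [hzeq]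
        exact hub_mem_of_diag hF hW hC_N hpN hδ₂ haN haR hbN hbR (hzeq ▸ hqB)
    obtain ⟨sx, hsx⟩ := exists_surgery_snap hn hω hX hBR hBA hBC hKB hKM hroute
      ⟨u, hu, g₀, hg₀, hugs, huK, hgsp ▸ hpK⟩ hc₀ hch hnd hsub hhead hfar hl hqD (hchainN hT')
    refine ⟨_, GadgetSpec.of_surgery hX sx ⟨p, ?_⟩⟩
    rw [hsx]
    rintro z (hz | ⟨-, hz⟩)
    · exact hB14 (hKB hz)
    · exact hB14 hz

end Local

end NTW17

end Literature.Probability.Percolation
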